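import Mathlib
import Literature.NumberTheory.LFunctions.WeilExplicit
import Literature.NumberTheory.LFunctions.WeilMarkovQuadratic
import Literature.NumberTheory.LFunctions.RiemannXi
import Summits.RiemannHypothesis.RiemannHypothesis.Theses.WeilWindowFlow

/-!
# Sketch — crux GronwallLeakage (stmt-RiemannHypothesis-1037), idea card `radical-frame`

First lemmas of the line "conjugate Weil's window form by the positive radical vector
Φ = Pólya–Riemann kernel (Φ̂ = ξ)". Statements only (crux-ideate stage: they must elaborate,
they need not be proved here).
-/

noncomputable section

open Real MeasureTheory Set
open scoped ArithmeticFunction.vonMangoldt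

namespace Summit.RiemannHypothesis.RiemannHypothesis.Cruxes.GronwallLeakage.RadicalFrame

/-- The Pólya–Riemann kernel `Φ(t) = 2 Σ_{n ≥ 1} (2π² n⁴ e^{9t/2} − 3π n² e^{5t/2}) exp(−π n² e^{2t})`
(Titchmarsh §10.1; Connes arXiv:2602.04022 §6.2, `k = 𝓔(h)`). It is even (theta transformation),
positive, decays like `exp(−π e^{2|t|} + 9|t|/2)`, and its Weil–Mellin transform in the tree
normalisation is Riemann's `ξ`: `∫ Φ(t) e^{(s−1/2)t} dt = ξ(s)` (so `∫ Φ e^{∓t/2} = ξ(0) = ξ(1) = 1/2`). -/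
def riemannPhi (t : ℝ) : ℝ :=
  2 * ∑' n : ℕ, (2 * π ^ 2 * ((n : ℝ) + 1) ^ 4 * Real.exp (9 * t / 2)
      - 3 * π * ((n : ℝ) + 1) ^ 2 * Real.exp (5 * t / 2))
    * Real.exp (-(π * ((n : ℝ) + 1) ^ 2 * Real.exp (2 * t)))

/-- (L1) Pólya's integral representation in the tree normalisation: `Φ̂ = ξ`. -/
def PolyaMellin : Prop :=
  ∀ s : ℂ, Literature.NumberTheory.LFunctions.weilMellin (fun t ↦ (riemannPhi t : ℂ)) s =
    Literature.NumberTheory.LFunctions.riemannXi s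

/-- (L2) Φ is `W`-harmonic: Weil's functional annihilates `ψ ⋆ Φ` for every test `ψ`
(explicit formula: `W(ψ ⋆ Φ) = Σ_ρ ψ̂(ρ) ξ(ρ) = 0`). Equivalently `(A + V)Φ = −cosh(·/2)` where
`A` is the archimedean multiplier and `V = −Σ Λ(n) n^{-1/2}(τ_{log n} + τ_{−log n})`. -/
def PolyaRadical : Prop :=
  ∀ ψ : ℝ → ℂ, Literature.NumberTheory.LFunctions.IsWeilTest ψ →
    Literature.NumberTheory.LFunctions.weilFunctional
      (Literature.NumberTheory.LFunctions.weilConv ψ (fun t ↦ (riemannPhi t : ℂ))) = 0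

/-- The `Φ`-weighted increment (variogram) of `f` at lag `t`:
`D^Φ_t(f) = ∫ (f(x+t) − f(x))² Φ(x) Φ(x+t) dx`. -/
def phiIncrement (f : ℝ → ℝ) (t : ℝ) : ℝ :=
  ∫ x : ℝ, (f (x + t) - f x) ^ 2 * riemannPhi x * riemannPhi (x + t)

/-- The radical-frame functional (a-INDEPENDENT): prime-lag variogram sum + archimedean variogram
integral − the pole part `∫∫ (f x − f y)² Φ x Φ y e^{(x−y)/2}` (= `¼ E[(f(X₊) − f(X₋))²]`,
`X± ∼ 2Φ(x)e^{±x/2}dx` independent probability laws, since `ξ(0) = ξ(1) = 1/2`). -/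
def radicalForm (f : ℝ → ℝ) : ℝ :=
  (∑' n : ℕ, (Λ n : ℝ) / Real.sqrt n * phiIncrement f (Real.log n)) +
    (∫ t in Ioi (0 : ℝ), Literature.NumberTheory.LFunctions.weilArchDensity t * phiIncrement f t) -
    ∫ x : ℝ, ∫ y : ℝ, (f x - f y) ^ 2 * riemannPhi x * riemannPhi y * Real.exp ((x - y) / 2)

/-- (L3) Polarisation ("carré du champ") of Weil's form in the radical frame: for real test `f`,
`Re Q(f Φ) = radicalForm f` — i.e. `Q(fΦ) = ½ ∫∫ (f x − f y)² Φ x Φ y K(x−y)`,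
`K = J − 2cosh(·/2)`, `J` = prime atoms `Λ(n) n^{-1/2} δ_{±log n}` + archimedean density. -/
def PolyaPolarisation : Prop :=
  ∀ f : ℝ → ℝ, Literature.NumberTheory.LFunctions.IsWeilTest (fun t ↦ (f t : ℂ)) →
    (Literature.NumberTheory.LFunctions.weilQuadratic (fun t ↦ ((f t * riemannPhi t : ℝ) : ℂ))).re =
      radicalForm f

/-- (L4) The window bottom in the radical frame: `ε(a)` is the infimum of the FIXED functional
`radicalForm` over real test `f` supported in `[-a, a]` with `∫ f² Φ² = 1`. -/
def RadicalFrameBottom : Prop :=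
  ∀ a : ℝ, 0 < a → Literature.NumberTheory.LFunctions.weilGroundEnergy a =
    sInf {x : ℝ | ∃ f : ℝ → ℝ, Literature.NumberTheory.LFunctions.IsWeilTest (fun t ↦ (f t : ℂ)) ∧
      tsupport f ⊆ Icc (-a) a ∧ ∫ t : ℝ, (f t) ^ 2 * (riemannPhi t) ^ 2 = 1 ∧ x = radicalForm f}

/-- TRANSFER TARGET `C⁺` (stronger than the crux on `[b₀, ∞)`, falsifiable): the bottom leaks at most
at four times the logarithmic edge-decay rate of Pólya's kernel plus a bounded amount,
`ε(a) ≥ ε(b) (Φ(a)/Φ(b))⁴ e^{−K₀ (a−b)}` for `b₀ ≤ b ≤ a` — i.e. Grönwall with the EXPLICIT rate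
`C(x) = −4 Φ'(x)/Φ(x) + K₀ = 8π e^{2x} + O(1)`. -/
def PolyaEnvelopeLeakage : Prop :=
  ∀ b₀ : ℝ, 0 < b₀ → ∃ K₀ : ℝ, ∀ b a : ℝ, b₀ ≤ b → b ≤ a →
    Literature.NumberTheory.LFunctions.weilGroundEnergy b *
        ((riemannPhi a / riemannPhi b) ^ 4 * Real.exp (-(K₀ * (a - b)))) ≤
      Literature.NumberTheory.LFunctions.weilGroundEnergy a

/-- Glue (real analysis only: `Φ > 0` smooth, `C := −4 Φ'/Φ + K₀` blockwise):
`PolyaEnvelopeLeakage → GronwallLeakage`. -/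
def PolyaEnvelopeGlue : Prop :=
  PolyaEnvelopeLeakage → Summit.RiemannHypothesis.RiemannHypothesis.Theses.WeilWindowFlow.GronwallLeakage

/-- BY-PRODUCT (unconditional, dissolves the disprover's near-miss `bottom_not_uniformly_positive_under_RH`
without any Dirichlet approximation): the window bottom is not bounded away from `0`. Proof route: the trial
function `g_a = χ_a · Φ` (smooth cutoff of Pólya's kernel to `[-a, a]`) has `‖g_a‖₂² → ‖Φ‖₂² > 0` and
`Q(g_a) = ½ ∫∫ (χ_a x − χ_a y)² Φ x Φ y K(x − y) → 0` (doubly-exponentially, `O(Φ(a−1))`) by `PolyaPolarisation`,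
or directly `Q(g_a) → W(Φ ⋆ Φ̃) = Σ_ρ ξ(ρ)·ξ(1−ρ) = 0` by `PolyaRadical`; hence `ε(a) ≤ Q(g_a)/‖g_a‖² → 0`. -/
def BottomNotUniformlyPositive : Prop :=
  ∀ δ : ℝ, 0 < δ → ∃ a : ℝ, 0 < a ∧ Literature.NumberTheory.LFunctions.weilGroundEnergy a < δ

/-- Quantitative form (deliberately weak, unconditional): a super-exponential UPPER envelope from the smoothly
truncated radical vector `χ_a Φ` (cutoff on `[a−1, a]`): the short-range part of `Q(χ_aΦ)` is `O(Φ(a−2))` by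
`(χ_a x − χ_a y)² ≤ ‖χ_a'‖²(x−y)²` against the `1/(2|t|)` singularity, the long-range part is `O(e^{a/2} Φ(a−1))` by
the radical identity `Σ Λ(n) n^{-1/2} Φ(y − log n) ≤ cosh(y/2) + M Φ(y)`. (The true bottom is conjecturally the
SQUARE of the first-order scale, `ε ≍ Φ(a)⁴ μ^{-9/2}`.) -/
def PolyaUpperEnvelope : Prop :=
  ∃ A₀ M : ℝ, ∀ a : ℝ, A₀ ≤ a →
    Literature.NumberTheory.LFunctions.weilGroundEnergy a ≤ M * Real.exp a * riemannPhi (a - 2)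

end Summit.RiemannHypothesis.RiemannHypothesis.Cruxes.GronwallLeakage.RadicalFrame

end
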